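import Literature.Computability.QuantumComplexity.OraclePathSums
import Literature.Computability.QuantumComplexity.ADHPathModel
import Literature.Computability.QuantumComplexity.SqrtTwoDyadicThresholds
import HarnessLib

/-!
# Walks through Clifford+`T` circuits WITH oracle gates: guessed answers, consistency, and the pair counts

Machine-independent half of the proof that the dyadic numerator `accGap` of the acceptance
probability of a uniform Clifford+`T` family with XOR-query gates is a `GapP^A` function
(`BQPRelSubsetAWPPRel.lean`: `BQPRel_subset_AWPPRel_of_accGap`; Fortnow–Rogers 1999, Thm. 3.1
with Lemma 3.2, "Theorem 3.1 relativizes", §3: `BQP^A ⊆ AWPP^A`), continuing `ADHPathModel.lean`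
(the total path semantics `ADH.tStep`/`ADH.tRun` of the ORACLE-FREE path-pair machine of
Adleman–DeMarrais–Huang, Lemma 6.10) and `OraclePathSums.lean` (paths through annotated gate
lists, `annPathRun`, and the pair counts `annSetA`, `annSetB`).

The counting machine (`OracleWalkMachine.lean`, `AccGapMachine.lean`) guesses, next to the choice
bit of every gate, an ANSWER bit, and walks the circuit on the guessed answers (an oracle gate
XORs the guessed bit into its answer wire); the oracle machine then asks the oracle the query of
every oracle gate along that walk (a truth-table reduction) and accepts only if every guessed bit
is the oracle's answer (and is `0` on the gate symbols). Exactly one guess vector per choice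
vector is consistent, so witness counts over (choices, guesses) are path counts. This file
provides that semantics and its counting identities, without machines:

* `isOr`, `gQry` (the query string of an oracle gate at a label, `Cryptography.queryOf`),
  `gStep g c a` (one total step driven by a choice bit `c` and an answer bit `a`; gate symbols
  step as `ADH.tStep`), `ansOf A g w` (the honest answer bit), `oStep`/`oRun` (the honest walk
  relative to `A`), `gRun` (the walk driven by a coin stream `c₀ a₀ c₁ a₁ ⋯`), `gQrys` (the
  queries along it), `gCons A` (consistency of the guesses with `A`), `gConsE` (consistency with
  a list of answer bits, what the machine checks) and `gConsE_answers` (fed the oracle's answers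
  to `gQrys`, the machine's check is `gCons`);
* `oRun_spec`: the honest walk computes `annPathRun (gs.map (·, A))` (endpoint, phase mod `8`,
  validity), as `ADH.tRun_spec`;
* **`sum_gCons`**: `Σ_{y ∈ {0,1}^{2μ}} [gCons y] · G(gRun y) = Σ_{b ∈ {0,1}^μ} G(oRun b)` — one
  consistent guess vector per choice vector;
* the class `clsO r₁ r₂ ∈ Option (Fin 8)`-like datum of a pair of final states (both valid, same
  label, accepting), `annSet_summand_eq_clsO`, and **`annSetA_eq_sum_oRun`,
  `annSetB_eq_sum_oRun`**: the pair counts `A_S`, `B_S` of the accepting labels as sums over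
  pairs of honest walks;
* the accepted classes `clsAcc s d` of the two relations (sign `s`), their multiplicities
  `clsWt k d ∈ {2^{k+1}, ⌊2^k √2⌋}`, the contribution `pairTerm s k` of a pair and
  **`sum_pairTerm_sub`**: the signed weighted class count over pairs of honest walks is
  `dyadicGap A_S B_S k` (`SqrtTwoDyadicThresholds.lean`);
* the multiplicity tests `uTest k d` on the counter block of the witness (odd classes:
  `(⟦u⟧ + 1)² ≤ 2·4^k`, i.e. `⟦u⟧ < ⌊2^k√2⌋`; even classes: no `1` from bit `k + 1` on) and their
  exact counts `cnt_uTest` (`= clsWt k d`), with `cnt_bitsToNat_lt`, `cnt_noTrue_and`.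

## References

* L. Fortnow, J. Rogers, *Complexity limitations on quantum computation*, J. Comput. System Sci.
  59 (1999) 240–252 (arXiv:cs/9811023), Lemma 3.2, Thm. 3.1, §3 ("Theorem 3.1 relativizes").
* L. M. Adleman, J. DeMarrais, M.-D. A. Huang, *Quantum computability*, SIAM J. Comput. 26 (1997),
  §6, Lemma 6.10 and its proof (the path-pair machine).
* C. H. Bennett, E. Bernstein, G. Brassard, U. Vazirani, *Strengths and weaknesses of quantum
  computing*, SIAM J. Comput. 26 (1997), §3 (oracle gates `|q, b⟩ ↦ |q, b ⊕ A(q)⟩`).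
-/

noncomputable section

namespace Literature.Computability.QuantumComplexity

namespace ADH

open _root_.Computability Complexity Cryptography SqrtTwoDyadic

variable {N : ℕ}

/-! ### One step driven by a choice bit and an answer bit -/

/-- Is the placed gate an oracle gate? [folklore] -/
def isOr : QGate cliffordT N → Bool
  | .oracle _ _ => true
  | .gate _ _ => false

/-- The query string of a gate at a basis label: `queryOf e w` for an oracle gate with wires `e`,
empty for a gate symbol. [cite: BennettBernsteinBrassardVazirani1997, §3] -/
def gQry : QGate cliffordT N → QReg N → List Bool
  | .oracle _ e, w => queryOf e w
  | .gate _ _, _ => []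

/-- **One total step driven by a choice bit `c` and an answer bit `a`**: a gate symbol steps as
`ADH.tStep` (the answer bit is ignored); an oracle gate XORs `a` into its answer wire, keeps the
phase (reduced modulo `8`) and, being non-branching, clears the validity flag on the choice bit `1`.
[cite: AdlemanDeMarraisHuang1997, §6 Lemma 6.10 (proof, step 3)] [cite: BennettBernsteinBrassardVazirani1997, §3] -/
def gStep : QGate cliffordT N → Bool → Bool → TState N → TState N
  | .oracle k e, c, a, (w, φ, v) =>
      (Function.update w (e (Fin.last k)) (w (e (Fin.last k)) ^^ a), φ % 8, v && !c)
  | .gate op e, c, _, s => tStep (.gate op e) c s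

/-- **The honest answer bit** of the gate `g` at the label `w` relative to `A`: `[gQry g w ∈ A]`
for an oracle gate, `0` for a gate symbol. [folklore] -/
def ansOf (A : Language Bool) (g : QGate cliffordT N) (w : QReg N) : Bool :=
  isOr g && A.boolIndicator (gQry g w)

/-- The honest step relative to `A`. [folklore] -/
def oStep (A : Language Bool) (g : QGate cliffordT N) (c : Bool) (s : TState N) : TState N :=
  gStep g c (ansOf A g s.1) s

/-- **The honest walk** relative to `A`, one choice bit per gate (read with `headBit`).
[cite: AdlemanDeMarraisHuang1997, §6 Lemma 6.10 (proof, step 3)] -/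
def oRun (A : Language Bool) : List (QGate cliffordT N) → List Bool → TState N → TState N
  | [], _, s => s
  | g :: gs, bs, s => oRun A gs bs.tail (oStep A g (headBit bs) s)

/-- **The guessed walk**: the coin stream carries, per gate, a choice bit and then a guessed
answer bit (`c₀ a₀ c₁ a₁ ⋯`, read with `headBit`). [folklore] -/
def gRun : List (QGate cliffordT N) → List Bool → TState N → TState N
  | [], _, s => s
  | g :: gs, cs, s => gRun gs (cs.drop 2) (gStep g (headBit cs) (headBit cs.tail) s)

/-- The queries along the guessed walk, one per gate (empty at gate symbols). [folklore] -/
def gQrys : List (QGate cliffordT N) → List Bool → TState N → List (List Bool)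
  | [], _, _ => []
  | g :: gs, cs, s => gQry g s.1 :: gQrys gs (cs.drop 2) (gStep g (headBit cs) (headBit cs.tail) s)

/-- **Consistency of the guesses with the oracle**: every guessed bit is the honest answer bit at
the label where it is consumed. [folklore] -/
def gCons (A : Language Bool) : List (QGate cliffordT N) → List Bool → TState N → Bool
  | [], _, _ => true
  | g :: gs, cs, s => (headBit cs.tail == ansOf A g s.1) &&
      gCons A gs (cs.drop 2) (gStep g (headBit cs) (headBit cs.tail) s)

/-- **Consistency of the guesses with a list of answer bits** `es` (one per gate; what the
machine checks): the guessed bit is the answer bit at an oracle gate and `0` at a gate symbol.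
[folklore] -/
def gConsE : List (QGate cliffordT N) → List Bool → List Bool → TState N → Bool
  | [], _, _, _ => true
  | g :: gs, cs, es, s => (headBit cs.tail == (isOr g && headBit es)) &&
      gConsE gs (cs.drop 2) es.tail (gStep g (headBit cs) (headBit cs.tail) s)

/-! ### Elementary properties -/

/-- `gQrys` has one entry per gate. [folklore] -/
@[simp] theorem length_gQrys (gs : List (QGate cliffordT N)) : ∀ (cs : List Bool) (s : TState N),
    (gQrys gs cs s).length = gs.length := by
  induction gs with
  | nil => intro cs s; rfl
  | cons g gs ih => intro cs s; simp [gQrys, ih]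

/-- **Fed the oracle's answers to its own queries, the machine's check is consistency with the
oracle.** [folklore] -/
theorem gConsE_answers (A : Language Bool) (gs : List (QGate cliffordT N)) :
    ∀ (cs rest : List Bool) (s : TState N),
    gConsE gs cs ((gQrys gs cs s).map A.boolIndicator ++ rest) s = gCons A gs cs s := by
  induction gs with
  | nil => intro cs rest s; rfl
  | cons g gs ih =>
    intro cs rest s
    simp only [gConsE, gQrys, gCons, List.map_cons, List.cons_append, headBit_cons, List.tail_cons, ih]
    rfl

/-- An invalid state stays invalid. [folklore] -/
theorem gStep_false (g : QGate cliffordT N) (c a : Bool) (w : QReg N) (φ : ℕ) :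
    (gStep g c a (w, φ, false)).2.2 = false := by
  cases g with
  | gate op e => exact tStep_false _ c w φ
  | oracle k e => simp [gStep]

/-- An invalid honest walk stays invalid to the end. [folklore] -/
theorem oRun_false (A : Language Bool) (gs : List (QGate cliffordT N)) :
    ∀ (bs : List Bool) (w : QReg N) (φ : ℕ), (oRun A gs bs (w, φ, false)).2.2 = false := by
  induction gs with
  | nil => intro bs w φ; rfl
  | cons g gs ih =>
    intro bs w φ
    simp only [oRun, oStep]
    rcases hs : gStep g (headBit bs) (ansOf A g w) (w, φ, false) with ⟨w', φ', v'⟩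
    have hv : v' = false := by simpa [hs] using gStep_false g (headBit bs) (ansOf A g w) w φ
    subst hv
    exact ih _ _ _

/-- **An honest step from a valid state agrees with `annPathStep`** at the annotation `A`: same
label, phase increment reduced modulo `8`, and the flag records validity. [folklore] -/
theorem oStep_true (A : Language Bool) (g : QGate cliffordT N) (c : Bool) (w : QReg N) (φ : ℕ) :
    oStep A g c (w, φ, true) =
      match annPathStep (g, A) c w with
      | some (w', ψ) => (w', (φ + ψ) % 8, true)
      | none => ((oStep A g c (w, φ, true)).1, (oStep A g c (w, φ, true)).2.1, false) := by
  cases g with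
  | gate op e =>
    have h := tStep_true (QGate.gate op e) c w φ
    simp only [oStep, gStep]
    cases op <;> exact h
  | oracle k e =>
    cases c
    · simp [oStep, gStep, ansOf, isOr, gQry, annPathStep, oracleTarget]
    · simp [oStep, gStep, annPathStep]

/-- **The honest walk computes the annotated path.** From a valid state and with at least one
coin per gate: if the path with choice bits `bs ↾ |gs|` is valid with endpoint `z` and phase
exponent `ψ`, the walk ends at `(z, (φ + ψ) mod 8, valid)`; otherwise it ends invalid.
[cite: AdlemanDeMarraisHuang1997, §6 Lemma 6.10 (proof, step 3)] -/
theorem oRun_spec (A : Language Bool) (gs : List (QGate cliffordT N)) :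
    ∀ (bs : List Bool) (w : QReg N) (φ : ℕ), φ < 8 → gs.length ≤ bs.length →
    match annPathRun (gs.map fun g => (g, A)) w (bs.take gs.length) with
    | some (z, ψ) => oRun A gs bs (w, φ, true) = (z, (φ + ψ) % 8, true)
    | none => (oRun A gs bs (w, φ, true)).2.2 = false := by
  induction gs with
  | nil =>
    intro bs w φ hφ _
    simp [annPathRun, oRun, Nat.mod_eq_of_lt hφ]
  | cons g gs ih =>
    intro bs w φ hφ hlen
    cases bs with
    | nil => simp at hlen
    | cons c bs =>
      simp only [List.length_cons, Nat.add_le_add_iff_right] at hlen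
      simp only [List.map_cons, List.length_cons, List.take_succ_cons, annPathRun, oRun, List.tail_cons,
        headBit_cons]
      rw [oStep_true]
      rcases hps : annPathStep (g, A) c w with _ | ⟨w', ψ⟩
      · simp only
        exact oRun_false A gs bs _ _
      · simp only
        have h := ih bs w' ((φ + ψ) % 8) (Nat.mod_lt _ (by norm_num)) hlen
        rcases hpr : annPathRun (gs.map fun g => (g, A)) w' (bs.take gs.length) with _ | ⟨z, ψ'⟩
        · simp only [hpr, Option.map_none] at h ⊢
          exact h
        · simp only [hpr, Option.map_some] at h ⊢
          rw [h]
          simp only [Prod.mk.injEq, true_and, and_true]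
          rw [Nat.mod_add_mod, Nat.add_assoc]

/-! ### One consistent guess vector per choice vector -/

/-- Splitting a sum over `{0,1}^{m+1}` over the first bit (twin of `QuantumComplexity.sum_vector_succ`,
`GapPClosure.lean`, which sits above this file's imports). [folklore] -/
theorem sum_vector_succ {β : Type*} [AddCommMonoid β] (m : ℕ) (f : List.Vector Bool (m + 1) → β) :
    ∑ v : List.Vector Bool (m + 1), f v = ∑ b : Bool, ∑ v : List.Vector Bool m, f (b ::ᵥ v) := by
  classical
  let e : Bool × List.Vector Bool m ≃ List.Vector Bool (m + 1) :=
    { toFun := fun p => p.1 ::ᵥ p.2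
      invFun := fun v => (v.head, v.tail)
      left_inv := fun p => by simp
      right_inv := fun v => List.Vector.cons_head_tail v }
  rw [← Fintype.sum_equiv e (fun p => f (p.1 ::ᵥ p.2)) f (fun p => rfl), Fintype.sum_prod_type]

/-- **One consistent guess vector per choice vector**: summing a function of the final state of
the guessed walk over the consistent coin streams of length `2μ` is summing it over the honest
walks on choice vectors of length `μ`. [folklore] -/
theorem sum_gCons {β : Type*} [AddCommMonoid β] (A : Language Bool) (gs : List (QGate cliffordT N)) :
    ∀ (m : ℕ), m = 2 * gs.length → ∀ (G : TState N → β) (s : TState N),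
    ∑ y : List.Vector Bool m, (if gCons A gs y.toList s = true then G (gRun gs y.toList s) else 0) =
      ∑ b : List.Vector Bool gs.length, G (oRun A gs b.toList s) := by
  induction gs with
  | nil =>
    intro m hm G s
    subst hm
    simp [gCons, gRun, oRun]
  | cons g gs ih =>
    intro m hm G s
    obtain ⟨m', rfl⟩ : ∃ m', m = m' + 1 + 1 := ⟨m - 2, by simp at hm; omega⟩
    have hm' : m' = 2 * gs.length := by simp at hm; omega
    show ∑ y : List.Vector Bool (m' + 1 + 1), _ = ∑ b : List.Vector Bool (gs.length + 1), _
    rw [sum_vector_succ (m' + 1), sum_vector_succ gs.length]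
    refine Finset.sum_congr rfl fun c _ => ?_
    rw [sum_vector_succ m', Fintype.sum_bool]
    simp only [List.Vector.toList_cons, gCons, gRun, oRun, oStep, headBit_cons, List.tail_cons, List.drop_succ_cons,
      List.drop_zero, Bool.and_eq_true, beq_iff_eq]
    have key : ∀ a : Bool,
        ∑ v : List.Vector Bool m',
          (if a = ansOf A g s.1 ∧ gCons A gs v.toList (gStep g c a s) = true then G (gRun gs v.toList (gStep g c a s)) else 0) =
        if a = ansOf A g s.1 then ∑ b : List.Vector Bool gs.length, G (oRun A gs b.toList (gStep g c a s)) else 0 := by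
      intro a
      by_cases ha : a = ansOf A g s.1
      · rw [if_pos ha, ← ih m' hm' G (gStep g c a s)]
        exact Finset.sum_congr rfl fun v _ => by simp [ha]
      · rw [if_neg ha]
        exact Finset.sum_eq_zero fun v _ => by simp [ha]
    rw [key, key]
    cases ansOf A g s.1 <;> simp

/-! ### The class of a pair of final states and the pair counts as sums over honest walks -/

/-- **The class datum of a pair of final states**: if both walks are valid and end at the same
ACCEPTING label (wire `0` reads `1`, `headBit` of the bit list), the phase-difference class
`(φ₁ − φ₂) mod 8 = (φ₁ + 7 φ₂) mod 8`; otherwise `none`. [cite: AdlemanDeMarraisHuang1997, §6 Lemma 6.10 (proof, steps 4–5)] -/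
def clsO (r₁ r₂ : TState N) : Option ℕ :=
  if r₁.2.2 = true ∧ r₂.2.2 = true ∧ r₁.1 = r₂.1 ∧ headBit (List.ofFn r₁.1) = true then
    some ((r₁.2.1 + 7 * r₂.2.1) % 8) else none

/-- Classes are residues modulo `8`. [folklore] -/
theorem lt_of_clsO_eq_some {r₁ r₂ : TState N} {d : ℕ} (h : clsO r₁ r₂ = some d) : d < 8 := by
  unfold clsO at h
  split_ifs at h
  rw [Option.some.injEq] at h
  omega

/-- Membership in the acceptance event is the first bit of the label. [folklore] -/
theorem mem_acceptEvent_iff_headBit (z : QReg N) : z ∈ QCircuit.acceptEvent N ↔ headBit (List.ofFn z) = true := by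
  unfold QCircuit.acceptEvent
  cases N with
  | zero => simp
  | succ N =>
    simp only [Set.mem_setOf_eq, List.ofFn_succ, headBit_cons]
    exact ⟨fun ⟨_, h⟩ => h, fun h => ⟨Nat.succ_pos _, h⟩⟩

open scoped Classical in
/-- **The pair-count summand read off the two honest walks** (what the machine computes): for
coin lists with at least one coin per gate, the summand of `annSetA`/`annSetB` (weight `f`) at the
accepting labels is `f` of the class datum of the final states.
[cite: AdlemanDeMarraisHuang1997, §6 Lemma 6.10 (proof, steps 3–5)] -/
theorem annSet_summand_eq_clsO (A : Language Bool) (f : ℕ → ℤ) (gs : List (QGate cliffordT N)) (w : QReg N)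
    (bs bs' : List Bool) (h : gs.length ≤ bs.length) (h' : gs.length ≤ bs'.length) :
    (match annPathRun (gs.map fun g => (g, A)) w (bs.take gs.length),
        annPathRun (gs.map fun g => (g, A)) w (bs'.take gs.length) with
      | some (z₁, φ), some (z₂, φ') =>
          if z₁ = z₂ ∧ z₁ ∈ QCircuit.acceptEvent N then f ((φ + 7 * φ') % 8) else 0
      | _, _ => (0 : ℤ)) =
      match clsO (oRun A gs bs (w, 0, true)) (oRun A gs bs' (w, 0, true)) with
      | some d => f d
      | none => 0 := by
  have h1 := oRun_spec A gs bs w 0 (by norm_num) h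
  have h2 := oRun_spec A gs bs' w 0 (by norm_num) h'
  unfold clsO
  rcases hp : annPathRun (gs.map fun g => (g, A)) w (bs.take gs.length) with _ | ⟨z₁, φ⟩ <;>
    rcases hp' : annPathRun (gs.map fun g => (g, A)) w (bs'.take gs.length) with _ | ⟨z₂, φ'⟩ <;>
    simp only [hp, hp'] at h1 h2 ⊢
  · simp [h1]
  · simp [h1]
  · simp [h2]
  · simp only [h1, h2, zero_add, true_and]
    have hiff : (z₁ = z₂ ∧ z₁ ∈ QCircuit.acceptEvent N) ↔ (z₁ = z₂ ∧ headBit (List.ofFn z₁) = true) :=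
      and_congr_right fun _ => mem_acceptEvent_iff_headBit z₁
    by_cases hz : z₁ = z₂ ∧ headBit (List.ofFn z₁) = true
    · rw [if_pos (hiff.2 hz), if_pos hz]
      congr 1
      omega
    · rw [if_neg (fun h => hz (hiff.1 h)), if_neg hz]

/-- Reindexing a double sum over choice functions as a double sum over bit vectors. [folklore] -/
theorem sum_fn_fn_eq_sum_vector {β : Type*} [AddCommMonoid β] {m n : ℕ} (h : m = n)
    (g : List Bool → List Bool → β) :
    ∑ b : Fin m → Bool, ∑ b' : Fin m → Bool, g (List.ofFn b) (List.ofFn b') =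
      ∑ u : List.Vector Bool n, ∑ u' : List.Vector Bool n, g u.toList u'.toList := by
  subst h
  rw [← sum_vector_eq_sum_fn m (fun l => ∑ b' : Fin m → Bool, g l (List.ofFn b'))]
  exact Finset.sum_congr rfl fun u _ => (sum_vector_eq_sum_fn m (fun l' => g u.toList l')).symm

open scoped Classical in
/-- **The pair counts of the accepting labels as sums over pairs of honest walks** (weight `f`).
[cite: AdlemanDeMarraisHuang1997, §6 Lemma 6.10 (proof)] -/
theorem annSet_eq_sum_oRun (A : Language Bool) (f : ℕ → ℤ) (gs : List (QGate cliffordT N)) (w : QReg N) :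
    (∑ b : Fin (gs.map fun g => (g, A)).length → Bool, ∑ b' : Fin (gs.map fun g => (g, A)).length → Bool,
      match annPathRun (gs.map fun g => (g, A)) w (List.ofFn b), annPathRun (gs.map fun g => (g, A)) w (List.ofFn b') with
      | some (z₁, φ), some (z₂, φ') =>
          if z₁ = z₂ ∧ z₁ ∈ QCircuit.acceptEvent N then f ((φ + 7 * φ') % 8) else 0
      | _, _ => (0 : ℤ)) =
      ∑ b : List.Vector Bool gs.length, ∑ b' : List.Vector Bool gs.length,
        match clsO (oRun A gs b.toList (w, 0, true)) (oRun A gs b'.toList (w, 0, true)) with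
        | some d => f d
        | none => 0 := by
  have hl : (gs.map fun g => (g, A)).length = gs.length := by simp
  refine (sum_fn_fn_eq_sum_vector hl (fun bs bs' =>
      match annPathRun (gs.map fun g => (g, A)) w bs, annPathRun (gs.map fun g => (g, A)) w bs' with
      | some (z₁, φ), some (z₂, φ') =>
          if z₁ = z₂ ∧ z₁ ∈ QCircuit.acceptEvent N then f ((φ + 7 * φ') % 8) else 0
      | _, _ => (0 : ℤ))).trans ?_
  refine Finset.sum_congr rfl fun b _ => Finset.sum_congr rfl fun b' _ => ?_
  have h := annSet_summand_eq_clsO A f gs w b.toList b'.toList (by simp) (by simp)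
  rwa [List.take_of_length_le (by simp), List.take_of_length_le (by simp)] at h

/-- **`A_S` of the accepting labels as a sum over pairs of honest walks.**
[cite: AdlemanDeMarraisHuang1997, §6 Lemma 6.10 (proof)] -/
theorem annSetA_eq_sum_oRun (A : Language Bool) (gs : List (QGate cliffordT N)) (w : QReg N) :
    annSetA (gs.map fun g => (g, A)) w (QCircuit.acceptEvent N) =
      ∑ b : List.Vector Bool gs.length, ∑ b' : List.Vector Bool gs.length,
        match clsO (oRun A gs b.toList (w, 0, true)) (oRun A gs b'.toList (w, 0, true)) with
        | some d => reA d
        | none => 0 := by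
  unfold annSetA
  exact annSet_eq_sum_oRun A reA gs w

/-- **`B_S` of the accepting labels as a sum over pairs of honest walks.**
[cite: AdlemanDeMarraisHuang1997, §6 Lemma 6.10 (proof)] -/
theorem annSetB_eq_sum_oRun (A : Language Bool) (gs : List (QGate cliffordT N)) (w : QReg N) :
    annSetB (gs.map fun g => (g, A)) w (QCircuit.acceptEvent N) =
      ∑ b : List.Vector Bool gs.length, ∑ b' : List.Vector Bool gs.length,
        match clsO (oRun A gs b.toList (w, 0, true)) (oRun A gs b'.toList (w, 0, true)) with
        | some d => reB d
        | none => 0 := by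
  unfold annSetB
  exact annSet_eq_sum_oRun A reB gs w

/-! ### The two relations: accepted classes and their multiplicities -/

/-- **The accepted classes** of the relation of sign `s`: the classes of positive weight
(`d = 0`: `reA = 1`; `d = 1, 7`: `reB = 1`) for `s = 1`, those of negative weight
(`d = 4`: `reA = -1`; `d = 3, 5`: `reB = -1`) for `s = 0`. [cite: FortnowRogers1999JCSS, Lemma 3.2 (arXiv numbering)] -/
def clsAcc (s : Bool) (d : ℕ) : Bool :=
  if s then decide (d = 0 ∨ d = 1 ∨ d = 7) else decide (d = 3 ∨ d = 4 ∨ d = 5)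

/-- **The multiplicity of a class** in the dyadic numerator with denominator exponent
`h + 1 + k`: `⌊2^k √2⌋` for the odd classes (the `√2/2`-part), `2^{k+1}` for the even ones (the
integer part). [cite: FortnowRogers1999JCSS, Lemma 3.2 (arXiv numbering)] -/
def clsWt (k d : ℕ) : ℕ := if d % 2 = 1 then sqrtTwoFloor k else 2 ^ (k + 1)

/-- The contribution of a pair of walks to the relation of sign `s`: the multiplicity of its
class if accepted, else `0`. [folklore] -/
def pairTerm (s : Bool) (k : ℕ) : Option ℕ → ℤ
  | some d => if clsAcc s d = true then (clsWt k d : ℤ) else 0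
  | none => 0

/-- `pairTerm` is nonnegative. [folklore] -/
theorem pairTerm_nonneg (s : Bool) (k : ℕ) (o : Option ℕ) : 0 ≤ pairTerm s k o := by
  rcases o with _ | d
  · simp [pairTerm]
  · simp only [pairTerm]; split_ifs <;> positivity

/-- The weighted value `2^{k+1} reA d + ⌊2^k√2⌋ reB d` of a class datum (`0` for `none`). [folklore] -/
def clsVal (k : ℕ) : Option ℕ → ℤ
  | some d => 2 ^ (k + 1) * reA d + (sqrtTwoFloor k : ℤ) * reB d
  | none => 0

/-- **The signed difference of the contributions is the weighted class value.** [folklore] -/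
theorem pairTerm_sub (k : ℕ) (o : Option ℕ) : pairTerm true k o - pairTerm false k o = clsVal k o := by
  rcases o with _ | d
  · simp [pairTerm, clsVal]
  · simp only [pairTerm, clsAcc, clsWt, clsVal, if_true, Bool.false_eq_true, if_false]
    rcases d with _ | _ | _ | _ | _ | _ | _ | _ | d <;> simp [reA, reB]

/-- **The signed weighted class count over pairs of honest walks is the dyadic numerator**
`dyadicGap A_S B_S k` of the accepting labels. [cite: FortnowRogers1999JCSS, Lemma 3.2 and Thm. 3.1 (arXiv numbering)] -/
theorem sum_pairTerm_sub (A : Language Bool) (gs : List (QGate cliffordT N)) (w : QReg N) (k : ℕ) :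
    (∑ b : List.Vector Bool gs.length, ∑ b' : List.Vector Bool gs.length,
        pairTerm true k (clsO (oRun A gs b.toList (w, 0, true)) (oRun A gs b'.toList (w, 0, true)))) -
      (∑ b : List.Vector Bool gs.length, ∑ b' : List.Vector Bool gs.length,
        pairTerm false k (clsO (oRun A gs b.toList (w, 0, true)) (oRun A gs b'.toList (w, 0, true)))) =
      dyadicGap (annSetA (gs.map fun g => (g, A)) w (QCircuit.acceptEvent N))
        (annSetB (gs.map fun g => (g, A)) w (QCircuit.acceptEvent N)) k := by
  rw [dyadicGap, annSetA_eq_sum_oRun, annSetB_eq_sum_oRun, Finset.mul_sum, Finset.mul_sum, ← Finset.sum_sub_distrib,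
    ← Finset.sum_add_distrib]
  refine Finset.sum_congr rfl fun b _ => ?_
  rw [Finset.mul_sum, Finset.mul_sum, ← Finset.sum_sub_distrib, ← Finset.sum_add_distrib]
  refine Finset.sum_congr rfl fun b' _ => ?_
  rw [pairTerm_sub]
  rcases clsO (oRun A gs b.toList (w, 0, true)) (oRun A gs b'.toList (w, 0, true)) with _ | d <;> simp [clsVal]

/-! ### The multiplicity tests on the counter block and their counts -/

/-- **The multiplicity test** on the counter block `u` for the class `d`: for an odd class,
`(⟦u⟧ + 1)² ≤ 2 · 4^k` (i.e. `⟦u⟧ < ⌊2^k √2⌋`, decided in integers); for an even class, the bits of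
`u` from position `k + 1` on are all `0` (i.e. `⟦u⟧ < 2^{k+1}` for `|u| ≥ k + 1`). [folklore] -/
def uTest (k d : ℕ) (u : List Bool) : Bool :=
  if d % 2 = 1 then decide ((bitsToNat u + 1) * (bitsToNat u + 1) ≤ 2 * 4 ^ k)
  else decide (true ∉ u.drop (k + 1))

/-- Exactly `θ` strings of length `b` have value `< θ`, for `θ ≤ 2^b` (little-endian `bitsToNat`).
[folklore] -/
theorem cnt_bitsToNat_lt : ∀ (b θ : ℕ), θ ≤ 2 ^ b → cnt b {y : List Bool | bitsToNat y < θ} = θ := by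
  intro b
  induction b with
  | zero =>
    intro θ hθ
    classical
    rw [cnt_zero]
    simp only [Set.mem_setOf_eq, bitsToNat_nil, pow_zero] at hθ ⊢
    split_ifs <;> omega
  | succ b ih =>
    intro θ hθ
    rw [cnt_succ]
    have h0 : {y : List Bool | false :: y ∈ {y : List Bool | bitsToNat y < θ}} = {y | bitsToNat y < (θ + 1) / 2} := by
      ext y; simp only [Set.mem_setOf_eq, bitsToNat_cons, Bool.toNat_false]; omega
    have h1 : {y : List Bool | true :: y ∈ {y : List Bool | bitsToNat y < θ}} = {y | bitsToNat y < θ / 2} := by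
      ext y; simp only [Set.mem_setOf_eq, bitsToNat_cons, Bool.toNat_true]; omega
    rw [h0, h1, ih _ (by rw [pow_succ] at hθ; omega), ih _ (by rw [pow_succ] at hθ; omega)]
    omega

/-- Exactly one string of each length has no `1` (twin of `Complexity.cnt_noTrue`, `CountingProofs.lean`,
not imported here). [folklore] -/
theorem cnt_noTrue (m : ℕ) : cnt m {y : List Bool | true ∉ y} = 1 := by
  induction m with
  | zero => classical rw [cnt_zero]; simp
  | succ m ih =>
    rw [cnt_succ]
    have h0 : {y : List Bool | false :: y ∈ {y : List Bool | true ∉ y}} = {y | true ∉ y} := by ext y; simp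
    have h1 : {y : List Bool | true :: y ∈ {y : List Bool | true ∉ y}} = {_y | False} := by ext y; simp
    rw [h0, h1, ih, cnt_const]
    simp

/-- `⌊2^k √2⌋ < 2^{k+1}`. [folklore] -/
theorem sqrtTwoFloor_lt (k : ℕ) : sqrtTwoFloor k < 2 ^ (k + 1) := by
  unfold sqrtTwoFloor
  rw [Nat.sqrt_lt]
  calc 2 * 4 ^ k < 4 * 4 ^ k := by have := Nat.one_le_pow k 4 (by norm_num); omega
    _ = 2 ^ (k + 1) * 2 ^ (k + 1) := by rw [← pow_succ', show (4 : ℕ) = 2 ^ 2 by norm_num, ← pow_mul, ← pow_add]; ring_nf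

/-- The odd test is the threshold `⟦u⟧ < ⌊2^k √2⌋`. [folklore] -/
theorem uTest_odd_iff (k : ℕ) (u : List Bool) :
    (bitsToNat u + 1) * (bitsToNat u + 1) ≤ 2 * 4 ^ k ↔ bitsToNat u < sqrtTwoFloor k := by
  rw [sqrtTwoFloor, ← Nat.le_sqrt, Nat.add_one_le_iff]

/-- **The counts of the multiplicity tests**: among the counter blocks of length `K ≥ k + 1`,
exactly `clsWt k d` pass the test of the class `d`. [folklore] -/
theorem cnt_uTest (k d K : ℕ) (hK : k + 1 ≤ K) : cnt K {u | uTest k d u = true} = clsWt k d := by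
  unfold uTest clsWt
  by_cases hd : d % 2 = 1
  · simp only [hd, if_true, decide_eq_true_eq]
    rw [show {u : List Bool | (bitsToNat u + 1) * (bitsToNat u + 1) ≤ 2 * 4 ^ k} = {u | bitsToNat u < sqrtTwoFloor k} from
      Set.ext fun u => uTest_odd_iff k u]
    exact cnt_bitsToNat_lt K _ ((sqrtTwoFloor_lt k).le.trans (Nat.pow_le_pow_right (by norm_num) hK))
  · simp only [hd, if_false, decide_eq_true_eq]
    obtain ⟨r, rfl⟩ := Nat.exists_eq_add_of_le hK
    rw [cnt_add_eq_sum]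
    have h : ∀ u : List.Vector Bool (k + 1), cnt r {v | u.toList ++ v ∈ {u : List Bool | true ∉ List.drop (k + 1) u}} = 1 := by
      intro u
      refine Eq.trans (cnt_congr fun v _ => ?_) (cnt_noTrue r)
      have hl : u.toList.length = k + 1 := by simp
      simp only [Set.mem_setOf_eq]
      rw [List.drop_append_of_le_length hl.ge, List.drop_of_length_le hl.le, List.nil_append]
    simp only [h, Finset.sum_const, Finset.card_univ, card_vector, Fintype.card_bool, smul_eq_mul, mul_one]

/-- Exactly one padding block of each length has no `1`; conditioned counts. [folklore] -/
theorem cnt_noTrue_and (m : ℕ) (P : Prop) [Decidable P] :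
    (cnt m {y : List Bool | true ∉ y ∧ P} : ℤ) = if P then 1 else 0 := by
  by_cases hP : P
  · rw [if_pos hP, show {y : List Bool | true ∉ y ∧ P} = {y | true ∉ y} from Set.ext fun y => by simp [hP], cnt_noTrue]
    rfl
  · rw [if_neg hP, show {y : List Bool | true ∉ y ∧ P} = {_y | False} from Set.ext fun y => by simp [hP], cnt_const]
    simp


end ADH

end Literature.Computability.QuantumComplexity

end
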